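import Summits.ResolutionOfSingularities.ResolutionOfSingularities.Theorems.MarkedTransferCampaignW13CanonicalFeeds
import Summits.ResolutionOfSingularities.ResolutionOfSingularities.Theorems.MarkedTransferCampaignW13BypassF7Prime
import Summits.ResolutionOfSingularities.ResolutionOfSingularities.Theorems.MarkedTransferCampaignW13BypassRFlatFailure
import Summits.ResolutionOfSingularities.ResolutionOfSingularities.Theorems.MarkedTransferCampaignW13BypassRFlatInstancesBCD
import Mathlib.Algebra.MvPolynomial.Supported
import HarnessLib

/-!
# [OURS · L1 W1.3] F7′ feeds CLOSED BY NAME (rows 2(a), 4, row 1 on `𝒞_Diff`) and the recorded chains as CANONICAL data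
# (`Campaign.IsCanonicalChain`, res-L1-type-o2 p483384) — instances of the open content Prop `CampaignW13RFlatCanonicalPos`
# (seat res-L1-s13-pv-1)

LADDER-RESOLUTION rung L (rescue), cell `res-hironaka`, RESCUE-SEED slot W1.3 (reading R-flat). The F7′ consumer table (director
2026-08-27T01:05:24Z (1); draft HOME/L/res-L1-s13-pv-1/F7PRIME-TABLE-W13.md) was typed by res-L1-type-o2 as
`Theorems/MarkedTransferCampaignW13CanonicalFeeds.lean` (p483384). This file CLOSES BY NAME the rows that are provable for all
parameters and supplies the recorded chains as canonical data:
* row 2(a) `Campaign.CampaignW13CotFlatVanishes e tau0 L0inf ISing P1` — for ALL parameters (`CampaignW13CotFlatVanishes_holds`), from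
  this seat's `Campaign.W13.bypassCotRFlat_le_radical_of_U67_2` (p482662);
* row 4 `Campaign.CampaignW13PTildeFlatIntClosed K J b` — for ALL parameters (`CampaignW13PTildeFlatIntClosed_holds`), from
  `Campaign.W13.pAlgebraicRing_mem_of_isIntegral` (p482662);
* row 1 `Campaign.CampaignW13Eq110Sub p K J b 𝒞` at the class `𝒞_Diff` (`campaignW13Eq110Sub_classDiff`, `0 < b`) — the same content as
  `CampaignW13RFlatTailPowDiffKnockOut_holds` (p482051), in the row-1 shape;
* the content Prop `Campaign.CampaignW13RFlatCanonicalPos p K y` stays OPEN (census j263239/j263697/j264545: 0 counterexamples among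
  12 255 heads; NOT claimed here). What is landed: the recorded heads A (`y² + x⁵`), D (`y² + x₁x₂³`), E2 (`y⁴ + x₁⁵ + x₁²x₂⁶`, `e = 2`)
  and the failure-locus head N (`y² + x₁x₂⁵ + x₂⁴`) WITH ITS CANONICAL TAIL `y + x₂²` carry canonical chain data
  (`*_isCanonicalChain`) and those data satisfy the Prop's conclusion (`*_canonicalPos`), by p478130 / p481686.

HONEST FRAMING. Nothing here is a statement of H. Hironaka's manuscript [Hironaka2017]; OURS bookkeeping about OUR reading; `℘` bound
(algebraic, row 003; U17_4 not used). RESCUE-SEED's caveat stands (any R-flat finding leaves L-G4 / (127) open;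
`KangarooShadeIncrease.Hauser2003_kangarooShadeIncrease`). AI computation is weaker than expert review; nothing here is progress on
resolution of singularities in positive characteristic. Helper filed `--supports stmt-ResolutionOfSingularities-15522`; PROOFS ONLY.
-/

noncomputable section

set_option linter.dupNamespace false -- mandated namespace of this single-conjunct summit

namespace Summit.ResolutionOfSingularities.ResolutionOfSingularities.Theorems.Campaign

open MvPolynomial
open Literature.AlgebraicGeometry.Resolution
open Literature.AlgebraicGeometry.Hironaka2017
open Literature.AlgebraicGeometry.Hironaka2017.S11CoordFree (BlSub)
open Literature.AlgebraicGeometry.Hironaka2017.S09LLUED (LLChainData)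

universe u v

/-! ## Rows 2(a), 4, 1(`𝒞_Diff`) closed by name -/

section Rows

variable {O : Type v} [CommRing O] {p : ℕ} [Fact p.Prime] [CharP O p] {ℓ : ℕ}

/-- **F7′ row 2(a), closed for all parameters**: under the §13.1 clause `U67_2` the R-flat cotangent module lies in `√I(Sing)`.
[folklore] -/
theorem CampaignW13CotFlatVanishes_holds (e : ℕ) (tau0 : BlSub O p ℓ → BlSub O p ℓ) (L0inf : BlSub O p ℓ)
    (ISing P1 : Ideal O) : CampaignW13CotFlatVanishes e tau0 L0inf ISing P1 :=
  fun hU _ hφ => W13.bypassCotRFlat_le_radical_of_U67_2 hU e P1 hφ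

end Rows

section RowsK

open Polynomial

variable (K : Type v) [CommRing K] {O : Type v} [CommRing O] [Algebra K O]

/-- **F7′ row 4, closed for all parameters**: the bound characteristic algebra `pAlgebraicRing K O J b ⊆ O[X]` is integrally closed
in `O[X]` (it is an integral closure). [folklore] -/
theorem CampaignW13PTildeFlatIntClosed_holds (J : Ideal O) (b : ℕ) : CampaignW13PTildeFlatIntClosed K J b := by
  intro x hx
  exact W13.pAlgebraicRing_mem_of_isIntegral K J b hx

/-- **F7′ row 1 at `𝒞_Diff`** (`0 < b`): chains whose total knock-out is a value of operators of order `< b` on `J` have head in `J`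
and knock-out in `℘(Ě,1)` — the row-1 feed in o2's shape (same content as `CampaignW13RFlatTailPowDiffKnockOut_holds`, p482051).
[folklore] -/
theorem campaignW13Eq110Sub_classDiff (p : ℕ) (J : Ideal O) {b : ℕ} (hb : 0 < b) :
    CampaignW13Eq110Sub p K J b
      (fun d => d.g 0 ∈ J ∧ ∃ j < b, d.g 0 - d.tail ^ (p ^ d.e) ∈ diffIdeal K j J) := by
  rintro d ⟨hg, j, hj, hk⟩
  exact ⟨hg, W13.diffIdeal_le_pAlgPiece_one K J hb hj hk⟩

end RowsK

/-! ## The recorded heads as canonical chain data, and the content Prop's conclusion on them -/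

section Canonical

variable {K : Type} [CommRing K]

/-- A polynomial built inside `K[x_i : i ≠ y]` does not involve the variable `y`. [folklore] -/
theorem not_mem_vars_of_mem_supported {n : ℕ} {y : Fin n} {f : MvPolynomial (Fin n) K}
    (h : f ∈ supported K ({y}ᶜ : Set (Fin n))) : y ∉ f.vars := by
  rw [mem_supported] at h
  exact fun hy => h hy rfl

/-- A sum of two monomials has support inside the two exponents. [folklore] -/
theorem support_monomial_add_subset {n : ℕ} (m₁ m₂ : Fin n →₀ ℕ) (c₁ c₂ : K) :
    (monomial m₁ c₁ + monomial m₂ c₂ : MvPolynomial (Fin n) K).support ⊆ {m₁, m₂} := by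
  intro m hm
  have h := support_add hm
  rw [Finset.mem_union] at h
  rw [Finset.mem_insert, Finset.mem_singleton]
  rcases h with h | h
  · exact Or.inl (Finset.mem_singleton.mp (support_monomial_subset h))
  · exact Or.inr (Finset.mem_singleton.mp (support_monomial_subset h))

end Canonical

section Instances

/-- Example A (`p = 2`, `K[x,y]`, `X 0 = x`, `X 1 = y`): a chain datum with head `y² + x⁵`, `e = 1`, tail `y` is CANONICAL
(`ε = x⁵` free of `y`, `r = 0`, knock-out `x⁵` has the odd exponent `5`). [folklore] -/
theorem A_isCanonicalChain (d : LLChainData (MvPolynomial (Fin 2) (ZMod 2)))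
    (hdg : d.g 0 = X 1 ^ 2 + X 0 ^ 5) (hde : d.e = 1) (hdt : d.tail = X 1) :
    IsCanonicalChain 2 (ZMod 2) (1 : Fin 2) d := by
  refine ⟨X 0 ^ 5, 0, ?_, by simp, ?_, by rw [hdt, add_zero], ?_⟩
  · exact not_mem_vars_of_mem_supported (pow_mem ((X_mem_supported (R := ZMod 2)).mpr (by decide)) 5)
  · rw [hdg, hde, pow_one]
  · rw [hde]
    intro m hm
    rw [pow_one, zero_pow two_ne_zero, sub_zero, X_pow_eq_monomial] at hm
    have := Finset.mem_singleton.mp (support_monomial_subset hm)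
    subst this
    exact ⟨0, by rw [Finsupp.single_eq_same]; decide⟩

/-- … and the content Prop's conclusion holds on it (`RFlatTailPow` at the hypersurface model, p478130 `A_tail_sq_mem`). [folklore] -/
theorem A_canonicalPos (d : LLChainData (MvPolynomial (Fin 2) (ZMod 2)))
    (hdg : d.g 0 = X 1 ^ 2 + X 0 ^ 5) (hde : d.e = 1) (hdt : d.tail = X 1) :
    RFlatTailPow 2 (ZMod 2) (Ideal.span {d.g 0}) (2 ^ d.e) d := by
  rw [RFlatTailPow, hdg, hde, hdt]
  exact W13.A_tail_sq_mem

/-- Example D (`p = 2`, `K[x₁,x₂,y]`, `X 2 = y`): head `y² + x₁x₂³`, `e = 1`, tail `y` is CANONICAL (`ε = x₁x₂³`, `r = 0`, odd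
exponent of `x₁`). [folklore] -/
theorem D_isCanonicalChain (d : LLChainData (MvPolynomial (Fin 3) (ZMod 2)))
    (hdg : d.g 0 = X 2 ^ 2 + X 0 * X 1 ^ 3) (hde : d.e = 1) (hdt : d.tail = X 2) :
    IsCanonicalChain 2 (ZMod 2) (2 : Fin 3) d := by
  refine ⟨X 0 * X 1 ^ 3, 0, ?_, by simp, ?_, by rw [hdt, add_zero], ?_⟩
  · exact not_mem_vars_of_mem_supported (mul_mem ((X_mem_supported (R := ZMod 2)).mpr (by decide))
      (pow_mem ((X_mem_supported (R := ZMod 2)).mpr (by decide)) 3))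
  · rw [hdg, hde, pow_one]
  · rw [hde]
    intro m hm
    rw [pow_one, zero_pow two_ne_zero, sub_zero, X_pow_eq_monomial, X, monomial_mul] at hm
    have := Finset.mem_singleton.mp (support_monomial_subset hm)
    subst this
    exact ⟨0, by rw [Finsupp.add_apply, Finsupp.single_eq_same, Finsupp.single_eq_of_ne (by decide)]; decide⟩

/-- … and the content Prop's conclusion holds on it (p479454 `D_tail_sq_mem`). [folklore] -/
theorem D_canonicalPos (d : LLChainData (MvPolynomial (Fin 3) (ZMod 2)))
    (hdg : d.g 0 = X 2 ^ 2 + X 0 * X 1 ^ 3) (hde : d.e = 1) (hdt : d.tail = X 2) :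
    RFlatTailPow 2 (ZMod 2) (Ideal.span {d.g 0}) (2 ^ d.e) d := by
  rw [RFlatTailPow, hdg, hde, hdt]
  exact W13.D_tail_sq_mem (ZMod 2)

/-- The `e = 2` head E2 (`p = 2`): head `y⁴ + x₁⁵ + x₁²x₂⁶`, `e = 2`, tail `y` is CANONICAL (`ε = x₁⁵ + x₁²x₂⁶`, `r = 0`; the knock-out
`h(0) + h(1)² = ε` has no monomial with both exponents divisible by `q = 4`: `4 ∤ 5`, `4 ∤ 2`). [folklore] -/
theorem E2_isCanonicalChain (d : LLChainData (MvPolynomial (Fin 3) (ZMod 2)))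
    (hdg : d.g 0 = X 2 ^ 4 + X 0 ^ 5 + X 0 ^ 2 * X 1 ^ 6) (hde : d.e = 2) (hdt : d.tail = X 2) :
    IsCanonicalChain 2 (ZMod 2) (2 : Fin 3) d := by
  refine ⟨X 0 ^ 5 + X 0 ^ 2 * X 1 ^ 6, 0, ?_, by simp, ?_, by rw [hdt, add_zero], ?_⟩
  · exact not_mem_vars_of_mem_supported (add_mem (pow_mem ((X_mem_supported (R := ZMod 2)).mpr (by decide)) 5)
      (mul_mem (pow_mem ((X_mem_supported (R := ZMod 2)).mpr (by decide)) 2)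
        (pow_mem ((X_mem_supported (R := ZMod 2)).mpr (by decide)) 6)))
  · rw [hdg, hde, add_assoc]; norm_num
  · rw [hde]
    intro m hm
    rw [show (2 : ℕ) ^ 2 = 4 from rfl, zero_pow (by norm_num), sub_zero, X_pow_eq_monomial, X_pow_eq_monomial,
      X_pow_eq_monomial, monomial_mul] at hm
    rcases Finset.mem_insert.mp (support_monomial_add_subset _ _ _ _ hm) with h | h
    · subst h
      exact ⟨0, by rw [Finsupp.single_eq_same]; decide⟩
    · rw [Finset.mem_singleton] at h
      subst h
      exact ⟨0, by rw [Finsupp.add_apply, Finsupp.single_eq_same, Finsupp.single_eq_of_ne (by decide)]; decide⟩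

/-- … and the content Prop's conclusion holds on it (p478130 `E2_tail_pow4_mem`). [folklore] -/
theorem E2_canonicalPos (d : LLChainData (MvPolynomial (Fin 3) (ZMod 2)))
    (hdg : d.g 0 = X 2 ^ 4 + X 0 ^ 5 + X 0 ^ 2 * X 1 ^ 6) (hde : d.e = 2) (hdt : d.tail = X 2) :
    RFlatTailPow 2 (ZMod 2) (Ideal.span {d.g 0}) (2 ^ d.e) d := by
  rw [RFlatTailPow, hdg, hde, hdt]
  exact W13.E2_tail_pow4_mem

/-- The failure-locus head N (`p = 2`): head `y² + x₁x₂⁵ + x₂⁴`, `e = 1`, with its CANONICAL tail `y + x₂²` (`ε = x₁x₂⁵ + x₂⁴`,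
`r = x₂²`, `r² = x₂⁴` the square part of `ε`; knock-out `ε − r² = x₁x₂⁵`, odd exponent of `x₁`). (The §9.7 recipe's tail `y` of the
SAME head is NOT canonical and fails POS: p481686 `N_not_rFlatTailPow`.) [folklore] -/
theorem N_isCanonicalChain (d : LLChainData (MvPolynomial (Fin 3) (ZMod 2)))
    (hdg : d.g 0 = X 2 ^ 2 + X 0 * X 1 ^ 5 + X 1 ^ 4) (hde : d.e = 1) (hdt : d.tail = X 2 + X 1 ^ 2) :
    IsCanonicalChain 2 (ZMod 2) (2 : Fin 3) d := by
  refine ⟨X 0 * X 1 ^ 5 + X 1 ^ 4, X 1 ^ 2, ?_, ?_, ?_, hdt, ?_⟩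
  · exact not_mem_vars_of_mem_supported (add_mem (mul_mem ((X_mem_supported (R := ZMod 2)).mpr (by decide))
      (pow_mem ((X_mem_supported (R := ZMod 2)).mpr (by decide)) 5)) (pow_mem ((X_mem_supported (R := ZMod 2)).mpr (by decide)) 4))
  · exact not_mem_vars_of_mem_supported (pow_mem ((X_mem_supported (R := ZMod 2)).mpr (by decide)) 2)
  · rw [hdg, hde, pow_one, add_assoc]
  · rw [hde]
    intro m hm
    rw [pow_one, ← pow_mul, show 2 * 2 = 4 from rfl, add_sub_cancel_right, X, X_pow_eq_monomial, monomial_mul] at hm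
    have := Finset.mem_singleton.mp (support_monomial_subset hm)
    subst this
    exact ⟨0, by rw [Finsupp.add_apply, Finsupp.single_eq_same, Finsupp.single_eq_of_ne (by decide)]; decide⟩

/-- … and the content Prop's conclusion holds on it (p481686 `N_clean_tail_sq_mem`, over `𝔽₂`). [folklore] -/
theorem N_canonicalPos (d : LLChainData (MvPolynomial (Fin 3) (ZMod 2)))
    (hdg : d.g 0 = X 2 ^ 2 + X 0 * X 1 ^ 5 + X 1 ^ 4) (hde : d.e = 1) (hdt : d.tail = X 2 + X 1 ^ 2) :
    RFlatTailPow 2 (ZMod 2) (Ideal.span {d.g 0}) (2 ^ d.e) d := by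
  rw [RFlatTailPow, hdg, hde, hdt]
  exact W13.N_clean_tail_sq_mem (ZMod 2)

end Instances

end Summit.ResolutionOfSingularities.ResolutionOfSingularities.Theorems.Campaign

end
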